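import Summits.QuantumFields.YangMills.Theorems.BalabanUVNodesN26AtTheta13OfThm1C
import Summits.QuantumFields.BalabanUV.Beta.RemainderThresholdSharp

/-!
# DAG node N26 — THE (D1)∕(D4) SEAM SLOPE IS THE RECORD's: under crux K2‴'s (D1) pin + residue the slope `stepBal Nc Lc` of a (D1) datum is the CESÀRO
# DRIFT OF THE RECORD's OWN ONE-LOOP NUMBERS `β⁰_θ` (one number per θ, the same for every datum, `≥ 0`); the registered stub
# `stub_d4AtSlopeCont13 : D4AtSlopeOfD1Record13` ⟺ ITS ONE-SLOPE-PER-θ FORM; and on node00-def-K0a's K0‴ candidate family θ₁₅ᶜ(e) ONE member meets rows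
# G, Z, N1 AND the seam AT EVERY (D1) DATUM's OWN SLOPE once the (D1) lane's sentence «the drifts stay ≥ d₀ > 0 along the family» is displayed

Cell `pub-ymgap`, YM-PLAN Track A (HUMAN RULING D-0062), seat `pub-ymgap-dag-n26-c` gen 8 (R134 acceleration seat, s2 = by-name knit at the record); helper for crux
K2‴ `EndpointGivenBR13` (stmt-QuantumFields-19911, route `BalabanUVNodes` rev 16∕17).  Plan g66's REGISTERED K2‴ skeleton (`K2Skeleton13.lean`, sha 3f282f2a…): stub 1
`stub_d1Residue13 : D1AtRecord13` (row (D1): at `(F, θ)` SOME datum `(Lc, Js, Nc)` whose step second moments ARE the record's one-loop numbers — the pin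
`∀ j, beta0OfMerged β_m θ.v₀ j = secondMoment (TbalOf Lc Js j) 0 1` — with `Gaps.D1Residue.Residue Lc Js Nc 0 1`), stub 2 `stub_d4AtSlopeCont13 : D4AtSlopeOfD1Record13` (rows
(D4) ∧ B4: for EVERY such datum, `∃ γ₀, 0 < γ₀ ≤ θ.γ ∧ AtSlopeCont (split₁₃ θ) γ₀ (stepBal Nc Lc)`), with
`β_m := betaMerged F (mergedTermFamilyMatT F 2 (TcanOfRecord F 2) (chiFixed29 F 2 θ.ν θ.ε₂₉) θ.εbg) θ.ρ8 θ.bV`.  Every N26 ∕ (D4) ∕ an4 face feeding stub 2 so far carries the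
slope as a FREE positive letter `s` (this lineage's p497784 §1c `exists_eps29_rows_theta13OfThm1C`; b2b-balaban-beta-an4 g128 §2; dag-ref-D READ-171's open question «whether the
members' (D1) slopes admit a common positive lower bound as `ε₂₉ ↓ 0`»).  This file removes the freedom: the slope is a function of θ alone.

WHAT IS HERE (0 `def`, 0 `sorry`; bookkeeping BY NAME over `Beta.Drift.OneLoopDrift`, `Gaps.D1Residue.d1Drift_of_residue` ∕ `oneLoopDrift_slope_unique` and p497784 §1c):
* §1 generic one-liners: `tendsto_div_of_oneLoopDrift` (a drifting sequence's Cesàro means converge to its slope), `stepBal_natCast_nonneg` (`0 ≤ stepBal N Lc` at a natural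
  block `Lc ≥ 1`, any real `N` — cell pub-balaban's `Beta.RemainderThresholdSharp.stepBal_nonneg` by name), `tendsto_div_of_residue_of_pin` ∕ `stepBal_eq_of_residue_of_pins` (a (D1)
  datum's slope is the Cesàro drift of the numbers its step moments are pinned on; two data pinned on the SAME numbers have the same slope — `Gaps.D1Residue` §5 by name).
* §2 AT THE STAGE-13 RECORD (general `N`, K2‴'s β-tokens verbatim): `tendsto_div_beta0_of_pin_residue₁₃` — under the pin + residue the Cesàro means of THE RECORD's one-loop
  numbers converge to `stepBal Nc Lc`; `stepBal_eq_of_two_data₁₃` — every (D1) datum at θ has the same slope; `exists_drift_nonneg_of_datum₁₃` — a datum exists ⇒ the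
  record's one-loop Cesàro drift exists and is `≥ 0` (so `stub_d1Residue13` already asserts the asymptotic-freedom SIGN-OR-ZERO of `β⁰_θ` in Cesàro mean at every admissible θ).
* §3 `d4AtSlopeOfD1Record13_iff_atDrift`: plan g66's `K2Skeleton13.D4AtSlopeOfD1Record13` (its text spelled VERBATIM, `N = 2`; the skeleton is not a tree module) ⟺ ITS ONE-SLOPE
  FORM «∀ F θ hP hθ, ∀ d, Tendsto (k ↦ (Σ_{j<k} β⁰_θ j)∕k) atTop (𝓝 d) → (∃ (D1) datum at θ) → ∃ γ₀, 0 < γ₀ ≤ θ.γ ∧ AtSlopeCont (split₁₃ θ) γ₀ d»: the `∀ (Lc, Js, Nc)` of the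
  registered stub COLLAPSES — the (D4) payer owes `AtSlopeCont` at ONE slope per θ, the record's own drift `d_θ`, and the seam row reads `θ.ε₂₉·K_rem,L(θ) ≤ d_θ`.
* §4 ON K0‴'s CANDIDATE FAMILY θ₁₅ᶜ(e) = `theta13OfThm1C F N ε₀ e B₃ a₀ a₁` (`K_rem,L` e-blind, p497784 `remCoeffL_faithful_theta13OfThm1C_eq`):
  `exists_eps29_rows_seam_at_data_theta13OfThm1C_of_drift_ge` — the (D1) lane's sentence typed as ONE displayed hypothesis `hd₀ : ∀ e, 0 < e → 4e < ε₀ → θ₁₅ᶜ(e) admissible → ∀ (Lc, Js, Nc),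
  pin(θ₁₅ᶜ(e)) → Residue → d₀ ≤ stepBal Nc Lc` («at the admissible members of the family the data's slopes — the members' one-loop Cesàro drifts by §2 — stay ≥ d₀ > 0») ⟹
  `∃ e > 0, 4e < ε₀ ∧ Admissible ∧ ZtUnity ∧ N1-faithful ∧ ∀ (Lc, Js, Nc), pin → Residue → e·K_rem,L ≤ stepBal Nc Lc`: ONE member meets rows G ∧ Z ∧ N1 AND THE SEAM AT EVERY (D1)
  DATUM's OWN SLOPE — `ε₂₉` chosen AFTER the drift floor and BEFORE the datum (p497784 §1c at `s := d₀`); and `…_of_cesaro_ge` — the same with `hd₀` in datum-free Cesàro form.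
* §5 `stepBal_colour_block_pos` (`0 < stepBal N F.L`), `stepBal_eq_print_of_print_datum₁₃` (at θ, ONE datum in print's letters — block `F.L`, colour numeral `N` — fixes every
  datum's slope to `stepBal N F.L`), ★ `exists_eps29_rows_seam_at_data_theta13OfThm1C_of_print_data`: if row (D1) is delivered IN PRINT's LETTERS at the admissible members (`hπ`), §4's
  `hd₀` holds with `d₀ := stepBal N F.L` — NO slope question is left and the seam row is paid by member choice like N1.

HONEST FRAMING.  Elementary real analysis (a Cesàro limit, Archimedes) over the tree's `OneLoopDrift`, the slope rigidity of `Gaps.D1Residue` and `Beta.RemainderThresholdSharp.stepBal_nonneg`,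
instantiated at the Stage-13 record;
`hd₀` is a HYPOTHESIS (row (D1)'s ∕ N25's sentence [I] (2.12)–(2.13) p. 268 at the record, in Cesàro form; print: the one-loop number does not read the (2.9) threshold — instance
0∕1 in the tree, the record's `β⁰` being `limUnder` objects); nothing of Bałaban's analysis is asserted; `stub_d4AtSlopeCont13` ∕ `stub_d1Residue13` ∕ K2‴ NOT proved; (D4) INSTANCE 0∕1;
N25 ∕ N26 NOT discharged (N26 VACATED ∕ (D4)-dependent; counts unmoved 5∕27 · A 5∕28); one finite four-torus programme at fixed ε per run — NOT the continuum limit, NOT ℝ⁴, NOT OS,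
NOT a mass gap, NOT Clay.  No `instance`, no `notation`, no `axiom`.
Sources (context): [I] = [Balaban1987RG1] CMP **109** (1987): Thm 2 p. 259 (first sentence), (1.20)–(1.22) p. 264, (2.9) p. 266, (2.12)–(2.14) p. 268, (5.10) p. 293;
[II] = [Balaban1988RG2Cluster] CMP **116** (1988): Lemma 3 (2.38) p. 20, p. 21; [15] = [Balaban1985Variational] CMP **102** (1985): Thm 1 p. 279.
-/

noncomputable section

open scoped Matrix.Norms.L2Operator

namespace Summit.QuantumFields.YangMills.Theorems.BalabanUVNodesN26SlopeOfRecord13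

open Literature.MathematicalPhysics.QuantumFieldTheory.Balaban1983to89
open Literature.MathematicalPhysics.QuantumFieldTheory.Balaban1983to89.FlowStep
open Literature.MathematicalPhysics.QuantumFieldTheory.Balaban1983to89.T4Continuum (T4Family)
open Literature.MathematicalPhysics.QuantumFieldTheory.Balaban1983to89.Node00
open Literature.MathematicalPhysics.QuantumFieldTheory.Balaban1983to89.B12TreeDecay (K₀)
open Literature.MathematicalPhysics.QuantumFieldTheory.Balaban1983to89.Beta.RemainderChainLattice
open Literature.MathematicalPhysics.QuantumFieldTheory.Balaban1983to89.Beta.Drift (OneLoopDrift)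
open Literature.MathematicalPhysics.QuantumFieldTheory.Balaban1983to89.Beta.OneStepKernelFamily (TbalOf)
open Literature.MathematicalPhysics.QuantumFieldTheory.Balaban1983to89.Beta.OneStepResolventKernel (JetData)
open Literature.MathematicalPhysics.QuantumFieldTheory.Balaban1983to89.B12Beta (secondMoment)
open Summit.QuantumFields.BalabanUV.Gaps
open Summit.QuantumFields.BalabanUV.Gaps.BetaContFromD4Chain
open Summit.QuantumFields.BalabanUV.Gaps.D1Residue (Residue d1Drift_of_residue oneLoopDrift_slope_unique)
open Summit.QuantumFields.YangMills.Theorems.BalabanUVNodesN26AtTheta13OfThm1C (exists_eps29_rows_theta13OfThm1C)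
open Filter Topology

/-! ## §1 Generic: a drifting sequence has its slope as Cesàro limit; a (D1) datum's slope is the Cesàro drift of the numbers it is pinned on -/

section Generic

/-- **A DRIFTING SEQUENCE's CESÀRO MEANS CONVERGE TO ITS SLOPE**: `OneLoopDrift b A β0` (`|Σ_{j<k} β0 j − b·k| ≤ A` for all `k`) ⟹ `(Σ_{j<k} β0 j)∕k → b`
(`|(Σ_{j<k} β0 j)∕k − b| ≤ A∕k`).  [folklore] -/
theorem tendsto_div_of_oneLoopDrift {b A : ℝ} {β0 : ℕ → ℝ} (h : OneLoopDrift b A β0) :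
    Tendsto (fun k : ℕ => (∑ j ∈ Finset.range k, β0 j) / k) atTop (𝓝 b) := by
  have hA : Tendsto (fun k : ℕ => A / (k : ℝ)) atTop (𝓝 0) := tendsto_const_nhds.div_atTop tendsto_natCast_atTop_atTop
  rw [tendsto_iff_norm_sub_tendsto_zero]
  refine squeeze_zero' (Eventually.of_forall fun k => norm_nonneg _) ?_ hA
  filter_upwards [eventually_gt_atTop 0] with k hk
  have hk' : (0 : ℝ) < k := Nat.cast_pos.mpr hk
  have e : (∑ j ∈ Finset.range k, β0 j) / k - b = (∑ j ∈ Finset.range k, β0 j - b * k) / k := by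
    field_simp
  rw [Real.norm_eq_abs, e, abs_div, abs_of_pos hk']
  exact div_le_div_of_nonneg_right (h k) hk'.le

/-- **The one-loop slope letter is non-negative for every real colour numeral at every natural block `Lc ≥ 1`** (the `NeZero Lc` of a (D1) datum):
`0 ≤ stepBal N Lc = 11N²∕(12π²)·log Lc` — cell pub-balaban's `Beta.RemainderThresholdSharp.stepBal_nonneg` (`1 ≤ L`, any real `N`) by name; the tree's `stepBal_pos` wants
`0 < N`, `1 < L`. [cite: Balaban1987RG1, (2.12) p.268 (bookkeeping of the printed coefficient)] -/
theorem stepBal_natCast_nonneg (N : ℝ) (Lc : ℕ) [NeZero Lc] : 0 ≤ B12Normalization.stepBal N (Lc : ℝ) :=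
  Summit.QuantumFields.BalabanUV.Beta.RemainderThresholdSharp.stepBal_nonneg N
    (by exact_mod_cast Nat.one_le_iff_ne_zero.mpr (NeZero.ne Lc))

variable {Lc Lc' : ℕ} [NeZero Lc] [NeZero Lc'] {Js : ℕ → JetData 3 Lc} {Js' : ℕ → JetData 3 Lc'} {Nc Nc' : ℝ} {μ ν : Fin 4} {β0 : ℕ → ℝ}

/-- **A (D1) DATUM's SLOPE IS THE CESÀRO DRIFT OF THE NUMBERS IT IS PINNED ON**: if the step second moments of `(Lc, Js)` ARE the numbers `β0` (the pin) and
`Gaps.D1Residue.Residue Lc Js Nc μ ν` holds, then `(Σ_{j<k} β0 j)∕k → stepBal Nc Lc` (`Gaps.D1Residue.d1Drift_of_residue` ∘ §1). [cite: Balaban1987RG1, (2.12)–(2.13) p.268] -/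
theorem tendsto_div_of_residue_of_pin (hβ : ∀ j, β0 j = secondMoment (TbalOf Lc Js j) μ ν) (h : Residue Lc Js Nc μ ν) :
    Tendsto (fun k : ℕ => (∑ j ∈ Finset.range k, β0 j) / k) atTop (𝓝 (B12Normalization.stepBal Nc Lc)) := by
  obtain ⟨A, hA⟩ := d1Drift_of_residue Js h
  have e : (fun j => secondMoment (TbalOf Lc Js j) μ ν) = β0 := funext fun j => (hβ j).symm
  rw [e] at hA
  exact tendsto_div_of_oneLoopDrift hA

/-- **TWO (D1) DATA PINNED ON THE SAME NUMBERS HAVE THE SAME SLOPE**: `stepBal Nc Lc = stepBal Nc' Lc'` (`Gaps.D1Residue.oneLoopDrift_slope_unique` by name: a sequence drifts with at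
most one slope). [cite: Balaban1987RG1, (2.12)–(2.13) p.268] -/
theorem stepBal_eq_of_residue_of_pins (hβ : ∀ j, β0 j = secondMoment (TbalOf Lc Js j) μ ν) (hβ' : ∀ j, β0 j = secondMoment (TbalOf Lc' Js' j) μ ν)
    (h : Residue Lc Js Nc μ ν) (h' : Residue Lc' Js' Nc' μ ν) : B12Normalization.stepBal Nc Lc = B12Normalization.stepBal Nc' Lc' := by
  obtain ⟨A, hA⟩ := d1Drift_of_residue Js h
  obtain ⟨A', hA'⟩ := d1Drift_of_residue Js' h'
  have e : (fun j => secondMoment (TbalOf Lc Js j) μ ν) = β0 := funext fun j => (hβ j).symm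
  have e' : (fun j => secondMoment (TbalOf Lc' Js' j) μ ν) = β0 := funext fun j => (hβ' j).symm
  rw [e] at hA
  rw [e'] at hA'
  exact oneLoopDrift_slope_unique hA hA'

end Generic

variable (F : T4Family) (N : ℕ) [NeZero N]

/-! ## §2 At the Stage-13 record: the seam slope is the Cesàro drift of the record's one-loop numbers — one per θ, the same for every datum, `≥ 0` -/

section AtRecord

variable (θ : Stage13Params F N)

/-- **UNDER K2‴'s (D1) PIN + RESIDUE AT `(F, N, θ)`, THE CESÀRO MEANS OF THE RECORD's ONE-LOOP NUMBERS CONVERGE TO THE DATUM's SLOPE**: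
`(Σ_{j<k} β⁰_θ j)∕k → stepBal Nc Lc`, `β⁰_θ j = beta0OfMerged β_m θ.v₀ j` with `β_m` the Stage-13 merged β (canonical transport, (2.9) species) — so the seam slope of
`D4AtSlopeOfD1Record13` is a function of θ ALONE: the Cesàro drift of the record's own one-loop numbers. [cite: Balaban1987RG1, (1.22) p.264 and (2.12)–(2.13) p.268] -/
theorem tendsto_div_beta0_of_pin_residue₁₃ {Lc : ℕ} [NeZero Lc] {Js : ℕ → JetData 3 Lc} {Nc : ℝ}
    (hβ : letI := θ.instVβ₁; letI := θ.instVβ₂; letI := θ.instιβ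
      ∀ j, beta0OfMerged (betaMerged F (mergedTermFamilyMatT F N (TcanOfRecord F N) (chiFixed29 F N θ.ν θ.ε₂₉) θ.εbg) θ.ρ8 θ.bV) θ.v₀ j =
        secondMoment (TbalOf Lc Js j) 0 1)
    (h : Residue Lc Js Nc 0 1) :
    letI := θ.instVβ₁; letI := θ.instVβ₂; letI := θ.instιβ
    Tendsto (fun k : ℕ => (∑ j ∈ Finset.range k,
      beta0OfMerged (betaMerged F (mergedTermFamilyMatT F N (TcanOfRecord F N) (chiFixed29 F N θ.ν θ.ε₂₉) θ.εbg) θ.ρ8 θ.bV) θ.v₀ j) / k)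
      atTop (𝓝 (B12Normalization.stepBal Nc Lc)) :=
  tendsto_div_of_residue_of_pin hβ h

/-- **EVERY (D1) DATUM AT θ HAS THE SAME SLOPE**: two data `(Lc, Js, Nc)`, `(Lc', Js', Nc')` pinned on the record's one-loop numbers at `(F, N, θ)` with their residues satisfy
`stepBal Nc Lc = stepBal Nc' Lc'`. [cite: Balaban1987RG1, (2.12)–(2.13) p.268] -/
theorem stepBal_eq_of_two_data₁₃ {Lc Lc' : ℕ} [NeZero Lc] [NeZero Lc'] {Js : ℕ → JetData 3 Lc} {Js' : ℕ → JetData 3 Lc'} {Nc Nc' : ℝ}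
    (hβ : letI := θ.instVβ₁; letI := θ.instVβ₂; letI := θ.instιβ
      ∀ j, beta0OfMerged (betaMerged F (mergedTermFamilyMatT F N (TcanOfRecord F N) (chiFixed29 F N θ.ν θ.ε₂₉) θ.εbg) θ.ρ8 θ.bV) θ.v₀ j =
        secondMoment (TbalOf Lc Js j) 0 1)
    (hβ' : letI := θ.instVβ₁; letI := θ.instVβ₂; letI := θ.instιβ
      ∀ j, beta0OfMerged (betaMerged F (mergedTermFamilyMatT F N (TcanOfRecord F N) (chiFixed29 F N θ.ν θ.ε₂₉) θ.εbg) θ.ρ8 θ.bV) θ.v₀ j =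
        secondMoment (TbalOf Lc' Js' j) 0 1)
    (h : Residue Lc Js Nc 0 1) (h' : Residue Lc' Js' Nc' 0 1) :
    B12Normalization.stepBal Nc Lc = B12Normalization.stepBal Nc' Lc' :=
  stepBal_eq_of_residue_of_pins hβ hβ' h h'

/-- **A (D1) DATUM EXISTS AT θ ⇒ THE RECORD's ONE-LOOP CESÀRO DRIFT EXISTS AND IS `≥ 0`** (`= stepBal Nc Lc = 11Nc²∕(12π²)·log Lc`, `Lc ≥ 1`): crux K2‴'s stub 1
`D1AtRecord13` already asserts, at every admissible θ, that the record's one-loop numbers have a non-negative Cesàro mean. [cite: Balaban1987RG1, (2.12)–(2.13) p.268] -/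
theorem exists_drift_nonneg_of_datum₁₃
    (hex : letI := θ.instVβ₁; letI := θ.instVβ₂; letI := θ.instιβ
      ∃ (Lc : ℕ) (_ : NeZero Lc) (Js : ℕ → JetData 3 Lc) (Nc : ℝ),
        (∀ j, beta0OfMerged (betaMerged F (mergedTermFamilyMatT F N (TcanOfRecord F N) (chiFixed29 F N θ.ν θ.ε₂₉) θ.εbg) θ.ρ8 θ.bV) θ.v₀ j =
          secondMoment (TbalOf Lc Js j) 0 1) ∧
        Residue Lc Js Nc 0 1) :
    letI := θ.instVβ₁; letI := θ.instVβ₂; letI := θ.instιβ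
    ∃ d : ℝ, 0 ≤ d ∧ Tendsto (fun k : ℕ => (∑ j ∈ Finset.range k,
      beta0OfMerged (betaMerged F (mergedTermFamilyMatT F N (TcanOfRecord F N) (chiFixed29 F N θ.ν θ.ε₂₉) θ.εbg) θ.ρ8 θ.bV) θ.v₀ j) / k) atTop (𝓝 d) := by
  obtain ⟨Lc, _, Js, Nc, hβ, h⟩ := hex
  exact ⟨B12Normalization.stepBal Nc Lc, stepBal_natCast_nonneg Nc Lc, tendsto_div_beta0_of_pin_residue₁₃ F N θ hβ h⟩

end AtRecord

/-! ## §3 Crux K2‴'s registered stub `D4AtSlopeOfD1Record13` ⟺ its ONE-SLOPE-PER-θ form: the `∀ (Lc, Js, Nc)` collapses to the record's drift -/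

section Stub

/-- **`K2Skeleton13.D4AtSlopeOfD1Record13` (text verbatim, `N = 2`) ⟺ «AT EVERY ADMISSIBLE θ WITH A (D1) DATUM, `AtSlopeCont` OF THE RECORD's SPLIT AT THE RECORD's ONE-LOOP CESÀRO
DRIFT»**: left, the registered stub (for every datum, `AtSlopeCont` at that datum's slope `stepBal Nc Lc` on some box `0 < γ₀ ≤ θ.γ`); right, for every real `d` which IS the
Cesàro limit of the record's one-loop numbers and provided SOME datum exists, `AtSlopeCont` at `d`.  (⇒) a datum's slope is that Cesàro limit (§2) and limits are unique; (⇐) instantiate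
`d := stepBal Nc Lc`.  So the (D4) payer owes ONE slope per θ, and the seam row of `AtSlopeCont` reads `θ.ε₂₉ · K_rem,L(θ) ≤ d_θ` with `d_θ` the record's own drift.
[cite: Balaban1987RG1, Thm 2 p.259 (first sentence), (1.20)–(1.22) p.264 and (2.12)–(2.13) p.268; Balaban1988RG2Cluster, Lemma 3 (2.38) p.20] -/
theorem d4AtSlopeOfD1Record13_iff_atDrift :
    (∀ (F : T4Family) (θ : Stage13Params F 2) (hP : θ.Provisos₁₃ F 2), θ.Admissible F 2 →
      letI := θ.instVβ₁; letI := θ.instVβ₂; letI := θ.instιβ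
      ∀ (Lc : ℕ) (_ : NeZero Lc) (Js : ℕ → JetData 3 Lc) (Nc : ℝ),
        (∀ j, beta0OfMerged (betaMerged F (mergedTermFamilyMatT F 2 (TcanOfRecord F 2) (chiFixed29 F 2 θ.ν θ.ε₂₉) θ.εbg) θ.ρ8 θ.bV) θ.v₀ j =
            B12Beta.secondMoment (TbalOf Lc Js j) 0 1) →
        D1Residue.Residue Lc Js Nc 0 1 →
        ∃ γ₀ : ℝ, 0 < γ₀ ∧ γ₀ ≤ θ.γ ∧
          AtSlopeCont
            (oneLoopSplit_betaOfMerged (betaMerged F (mergedTermFamilyMatT F 2 (TcanOfRecord F 2) (chiFixed29 F 2 θ.ν θ.ε₂₉) θ.εbg) θ.ρ8 θ.bV)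
              (beta0OfMerged (betaMerged F (mergedTermFamilyMatT F 2 (TcanOfRecord F 2) (chiFixed29 F 2 θ.ν θ.ε₂₉) θ.εbg) θ.ρ8 θ.bV) θ.v₀) θ.γ)
            γ₀ (B12Normalization.stepBal Nc Lc)) ↔
    (∀ (F : T4Family) (θ : Stage13Params F 2) (hP : θ.Provisos₁₃ F 2), θ.Admissible F 2 →
      letI := θ.instVβ₁; letI := θ.instVβ₂; letI := θ.instιβ
      ∀ d : ℝ,
        Tendsto (fun k : ℕ => (∑ j ∈ Finset.range k,
          beta0OfMerged (betaMerged F (mergedTermFamilyMatT F 2 (TcanOfRecord F 2) (chiFixed29 F 2 θ.ν θ.ε₂₉) θ.εbg) θ.ρ8 θ.bV) θ.v₀ j) / k) atTop (𝓝 d) →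
        (∃ (Lc : ℕ) (_ : NeZero Lc) (Js : ℕ → JetData 3 Lc) (Nc : ℝ),
          (∀ j, beta0OfMerged (betaMerged F (mergedTermFamilyMatT F 2 (TcanOfRecord F 2) (chiFixed29 F 2 θ.ν θ.ε₂₉) θ.εbg) θ.ρ8 θ.bV) θ.v₀ j =
              B12Beta.secondMoment (TbalOf Lc Js j) 0 1) ∧
          D1Residue.Residue Lc Js Nc 0 1) →
        ∃ γ₀ : ℝ, 0 < γ₀ ∧ γ₀ ≤ θ.γ ∧
          AtSlopeCont
            (oneLoopSplit_betaOfMerged (betaMerged F (mergedTermFamilyMatT F 2 (TcanOfRecord F 2) (chiFixed29 F 2 θ.ν θ.ε₂₉) θ.εbg) θ.ρ8 θ.bV)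
              (beta0OfMerged (betaMerged F (mergedTermFamilyMatT F 2 (TcanOfRecord F 2) (chiFixed29 F 2 θ.ν θ.ε₂₉) θ.εbg) θ.ρ8 θ.bV) θ.v₀) θ.γ)
            γ₀ d) := by
  constructor
  · intro h F θ hP hθ d hd hex
    obtain ⟨Lc, inst, Js, Nc, hβ, hres⟩ := hex
    have hlim := tendsto_div_beta0_of_pin_residue₁₃ F 2 θ hβ hres
    have hd' : d = B12Normalization.stepBal Nc Lc := tendsto_nhds_unique hd hlim
    rw [hd']
    exact h F θ hP hθ Lc inst Js Nc hβ hres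
  · intro h F θ hP hθ Lc inst Js Nc hβ hres
    exact h F θ hP hθ (B12Normalization.stepBal Nc Lc) (tendsto_div_beta0_of_pin_residue₁₃ F 2 θ hβ hres) ⟨Lc, inst, Js, Nc, hβ, hres⟩

end Stub

/-! ## §4 On K0‴'s candidate family θ₁₅ᶜ(e): rows G, Z, N1 AND the seam AT EVERY (D1) DATUM's OWN SLOPE, once the drifts stay `≥ d₀ > 0` along the family -/

section Family

variable (ε₀ B₃ a₀ a₁ : ℝ) (c₀ : B13.Consts) (M : ℕ) (α₂ B : ℝ)

variable {ε₀ B₃ a₀ a₁} in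
/-- **★ ONE MEMBER OF THE [15]-KEYED FAMILY MEETS ROW G, ROW Z, N26's N1 ROW AND THE (D1)∕(D4) SEAM ROW AT EVERY (D1) DATUM's OWN SLOPE**, given the (D1) lane's sentence as the ONE
displayed hypothesis `hd₀`: at every ADMISSIBLE member `0 < e`, `4e < ε₀` of the family `e ↦ θ₁₅ᶜ(ε₀, e; B₃, a₀, a₁)`, every (D1) datum `(Lc, Js, Nc)` pinned on the member's one-loop
numbers with its residue has slope `stepBal Nc Lc ≥ d₀` (by §2: the members' one-loop Cesàro drifts stay `≥ d₀`; print: `β⁰_{k+1}` does not read the (2.9) threshold, [I]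
(2.12)–(2.13)).  Then for some `0 < ε₂₉` with `4ε₂₉ < ε₀`: θ₁₅ᶜ is Stage-13 ADMISSIBLE, carries `ZtUnity`, meets N1 at its faithful letters (minimal `A₂`), AND `ε₂₉ · K_rem,L ≤ stepBal Nc Lc`
for EVERY datum of that member — p497784 `exists_eps29_rows_theta13OfThm1C` at the slope `s := d₀`, then `hd₀` (`ε₂₉` chosen after `d₀`, before the datum).  Satisfiability of
the displayed rows; `hd₀` NOT proved (instance 0∕1); nothing of Bałaban's. [cite: Balaban1987RG1, (0.21) p.256, (1.2) p.260, (2.9) p.266, (2.12)–(2.13) p.268 and (1.22) p.264; Balaban1988RG2Cluster, Lemma 3 (2.38) p.20 and p.21; Balaban1988Convergent, (2.10) p.256; Balaban1985Variational, Thm 1 p.279] -/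
theorem exists_eps29_rows_seam_at_data_theta13OfThm1C_of_drift_ge (hε : 0 < ε₀) (hB : 0 ≤ B₃) (ha₀ : 0 < a₀) (ha₁ : 0 < a₁) {d₀ : ℝ}
    (hd₀pos : 0 < d₀)
    (hd₀ : ∀ e : ℝ, 0 < e → 4 * e < ε₀ → (theta13OfThm1C F N ε₀ e B₃ a₀ a₁).Admissible F N →
      letI := (theta13OfThm1C F N ε₀ e B₃ a₀ a₁).instVβ₁; letI := (theta13OfThm1C F N ε₀ e B₃ a₀ a₁).instVβ₂
      letI := (theta13OfThm1C F N ε₀ e B₃ a₀ a₁).instιβ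
      ∀ (Lc : ℕ) (_ : NeZero Lc) (Js : ℕ → JetData 3 Lc) (Nc : ℝ),
        (∀ j, beta0OfMerged (betaMerged F (mergedTermFamilyMatT F N (TcanOfRecord F N)
            (chiFixed29 F N (theta13OfThm1C F N ε₀ e B₃ a₀ a₁).ν (theta13OfThm1C F N ε₀ e B₃ a₀ a₁).ε₂₉) (theta13OfThm1C F N ε₀ e B₃ a₀ a₁).εbg)
            (theta13OfThm1C F N ε₀ e B₃ a₀ a₁).ρ8 (theta13OfThm1C F N ε₀ e B₃ a₀ a₁).bV) (theta13OfThm1C F N ε₀ e B₃ a₀ a₁).v₀ j =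
          secondMoment (TbalOf Lc Js j) 0 1) →
        Residue Lc Js Nc 0 1 → d₀ ≤ B12Normalization.stepBal Nc Lc) :
    ∃ ε₂₉ : ℝ, 0 < ε₂₉ ∧ 4 * ε₂₉ < ε₀ ∧
      (theta13OfThm1C F N ε₀ ε₂₉ B₃ a₀ a₁).Admissible F N ∧ (theta13OfThm1C F N ε₀ ε₂₉ B₃ a₀ a₁).ZtUnity F N ∧
      CondsL 4 (c13OfRecord₁₂ F N (theta13OfThm1C F N ε₀ ε₂₉ B₃ a₀ a₁).toStage12Params
          { c₀ with ε₁ := ε₂₉, A₂ := Real.exp 1 * 9 * 64 * K₀ 64 8 ^ 2 })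
        (((c13OfRecord₁₂ F N (theta13OfThm1C F N ε₀ ε₂₉ B₃ a₀ a₁).toStage12Params
          { c₀ with ε₁ := ε₂₉, A₂ := Real.exp 1 * 9 * 64 * K₀ 64 8 ^ 2 }).L : ℝ) / 2) ∧
      letI := (theta13OfThm1C F N ε₀ ε₂₉ B₃ a₀ a₁).instVβ₁; letI := (theta13OfThm1C F N ε₀ ε₂₉ B₃ a₀ a₁).instVβ₂
      letI := (theta13OfThm1C F N ε₀ ε₂₉ B₃ a₀ a₁).instιβ
      ∀ (Lc : ℕ) (_ : NeZero Lc) (Js : ℕ → JetData 3 Lc) (Nc : ℝ),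
        (∀ j, beta0OfMerged (betaMerged F (mergedTermFamilyMatT F N (TcanOfRecord F N)
            (chiFixed29 F N (theta13OfThm1C F N ε₀ ε₂₉ B₃ a₀ a₁).ν (theta13OfThm1C F N ε₀ ε₂₉ B₃ a₀ a₁).ε₂₉) (theta13OfThm1C F N ε₀ ε₂₉ B₃ a₀ a₁).εbg)
            (theta13OfThm1C F N ε₀ ε₂₉ B₃ a₀ a₁).ρ8 (theta13OfThm1C F N ε₀ ε₂₉ B₃ a₀ a₁).bV) (theta13OfThm1C F N ε₀ ε₂₉ B₃ a₀ a₁).v₀ j =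
          secondMoment (TbalOf Lc Js j) 0 1) →
        Residue Lc Js Nc 0 1 →
        ε₂₉ * remCoeffL 4 M (c13OfRecord₁₂ F N (theta13OfThm1C F N ε₀ ε₂₉ B₃ a₀ a₁).toStage12Params
            { c₀ with ε₁ := ε₂₉, A₂ := Real.exp 1 * 9 * 64 * K₀ 64 8 ^ 2 }) α₂ B ≤ B12Normalization.stepBal Nc Lc := by
  obtain ⟨e, he0, he4, hadm, hZ, hC, hseam⟩ := exists_eps29_rows_theta13OfThm1C F N c₀ M α₂ B hε hB ha₀ ha₁ hd₀pos
  exact ⟨e, he0, he4, hadm, hZ, hC, fun Lc inst Js Nc hβ hres => hseam.trans (hd₀ e he0 he4 hadm Lc inst Js Nc hβ hres)⟩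

variable {ε₀ B₃ a₀ a₁} in
/-- **The same with the (D1) lane's sentence in DATUM-FREE Cesàro form**: `hd₀ : ∀ e, 0 < e → 4e < ε₀ → θ₁₅ᶜ(e) admissible → ∀ d, Tendsto (k ↦ (Σ_{j<k} β⁰_{θ₁₅ᶜ(e)} j)∕k) atTop (𝓝 d) → d₀ ≤ d` («every Cesàro
limit of a member's one-loop numbers along the admissible range is `≥ d₀`») ⟹ the rows + the seam at every datum's slope at one member (§2 turns a datum's slope into such a limit).
[cite: Balaban1987RG1, (2.9) p.266, (2.12)–(2.13) p.268 and (1.22) p.264; Balaban1988RG2Cluster, Lemma 3 (2.38) p.20; Balaban1985Variational, Thm 1 p.279] -/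
theorem exists_eps29_rows_seam_at_data_theta13OfThm1C_of_cesaro_ge (hε : 0 < ε₀) (hB : 0 ≤ B₃) (ha₀ : 0 < a₀) (ha₁ : 0 < a₁) {d₀ : ℝ}
    (hd₀pos : 0 < d₀)
    (hd₀ : ∀ e : ℝ, 0 < e → 4 * e < ε₀ → (theta13OfThm1C F N ε₀ e B₃ a₀ a₁).Admissible F N →
      letI := (theta13OfThm1C F N ε₀ e B₃ a₀ a₁).instVβ₁; letI := (theta13OfThm1C F N ε₀ e B₃ a₀ a₁).instVβ₂
      letI := (theta13OfThm1C F N ε₀ e B₃ a₀ a₁).instιβ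
      ∀ d : ℝ, Tendsto (fun k : ℕ => (∑ j ∈ Finset.range k,
        beta0OfMerged (betaMerged F (mergedTermFamilyMatT F N (TcanOfRecord F N)
            (chiFixed29 F N (theta13OfThm1C F N ε₀ e B₃ a₀ a₁).ν (theta13OfThm1C F N ε₀ e B₃ a₀ a₁).ε₂₉) (theta13OfThm1C F N ε₀ e B₃ a₀ a₁).εbg)
            (theta13OfThm1C F N ε₀ e B₃ a₀ a₁).ρ8 (theta13OfThm1C F N ε₀ e B₃ a₀ a₁).bV) (theta13OfThm1C F N ε₀ e B₃ a₀ a₁).v₀ j) / k) atTop (𝓝 d) →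
        d₀ ≤ d) :
    ∃ ε₂₉ : ℝ, 0 < ε₂₉ ∧ 4 * ε₂₉ < ε₀ ∧
      (theta13OfThm1C F N ε₀ ε₂₉ B₃ a₀ a₁).Admissible F N ∧ (theta13OfThm1C F N ε₀ ε₂₉ B₃ a₀ a₁).ZtUnity F N ∧
      CondsL 4 (c13OfRecord₁₂ F N (theta13OfThm1C F N ε₀ ε₂₉ B₃ a₀ a₁).toStage12Params
          { c₀ with ε₁ := ε₂₉, A₂ := Real.exp 1 * 9 * 64 * K₀ 64 8 ^ 2 })
        (((c13OfRecord₁₂ F N (theta13OfThm1C F N ε₀ ε₂₉ B₃ a₀ a₁).toStage12Params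
          { c₀ with ε₁ := ε₂₉, A₂ := Real.exp 1 * 9 * 64 * K₀ 64 8 ^ 2 }).L : ℝ) / 2) ∧
      letI := (theta13OfThm1C F N ε₀ ε₂₉ B₃ a₀ a₁).instVβ₁; letI := (theta13OfThm1C F N ε₀ ε₂₉ B₃ a₀ a₁).instVβ₂
      letI := (theta13OfThm1C F N ε₀ ε₂₉ B₃ a₀ a₁).instιβ
      ∀ (Lc : ℕ) (_ : NeZero Lc) (Js : ℕ → JetData 3 Lc) (Nc : ℝ),
        (∀ j, beta0OfMerged (betaMerged F (mergedTermFamilyMatT F N (TcanOfRecord F N)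
            (chiFixed29 F N (theta13OfThm1C F N ε₀ ε₂₉ B₃ a₀ a₁).ν (theta13OfThm1C F N ε₀ ε₂₉ B₃ a₀ a₁).ε₂₉) (theta13OfThm1C F N ε₀ ε₂₉ B₃ a₀ a₁).εbg)
            (theta13OfThm1C F N ε₀ ε₂₉ B₃ a₀ a₁).ρ8 (theta13OfThm1C F N ε₀ ε₂₉ B₃ a₀ a₁).bV) (theta13OfThm1C F N ε₀ ε₂₉ B₃ a₀ a₁).v₀ j =
          secondMoment (TbalOf Lc Js j) 0 1) →
        Residue Lc Js Nc 0 1 →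
        ε₂₉ * remCoeffL 4 M (c13OfRecord₁₂ F N (theta13OfThm1C F N ε₀ ε₂₉ B₃ a₀ a₁).toStage12Params
            { c₀ with ε₁ := ε₂₉, A₂ := Real.exp 1 * 9 * 64 * K₀ 64 8 ^ 2 }) α₂ B ≤ B12Normalization.stepBal Nc Lc :=
  exists_eps29_rows_seam_at_data_theta13OfThm1C_of_drift_ge F N c₀ M α₂ B hε hB ha₀ ha₁ hd₀pos fun e he0 he4 hadm _ _ _ _ hβ hres =>
    hd₀ e he0 he4 hadm _ (tendsto_div_beta0_of_pin_residue₁₃ F N (theta13OfThm1C F N ε₀ e B₃ a₀ a₁) hβ hres)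

end Family

/-! ## §5 … and NO slope question is left if row (D1) is delivered IN PRINT's LETTERS (block `F.L`, colour numeral `N`): every datum then has the slope `stepBal N F.L > 0` -/

section Print

/-- **Print's one-loop slope is positive**: `0 < stepBal N F.L = 11N²∕(12π²)·log F.L` (`N ≥ 1`, `F.L > 11`; `B12Normalization.stepBal_pos`).
[cite: Balaban1987RG1, (2.12) p.268, p.251 («L > 11»)] -/
theorem stepBal_colour_block_pos : 0 < B12Normalization.stepBal (N : ℝ) (F.L : ℝ) :=
  B12Normalization.stepBal_pos (Nat.cast_pos.mpr (Nat.pos_of_neZero N)) (by exact_mod_cast F.hL.2)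

variable [NeZero F.L] (θ : Stage13Params F N)

/-- **AT θ: ONE (D1) DATUM IN PRINT's LETTERS FIXES EVERY DATUM's SLOPE TO PRINT's** — if some step jets `Js₀` on the block `F.L` are pinned on the record's one-loop numbers with
`Residue F.L Js₀ N 0 1` (row (D1) as [I] (2.12)–(2.13) states it: block `L`, colour `N`), then every (D1) datum `(Lc, Js, Nc)` at θ has `stepBal Nc Lc = stepBal N F.L` (§2's rigidity).
[cite: Balaban1987RG1, (2.12)–(2.13) p.268] -/
theorem stepBal_eq_print_of_print_datum₁₃ {Lc : ℕ} [NeZero Lc] {Js : ℕ → JetData 3 Lc} {Nc : ℝ}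
    (hβ : letI := θ.instVβ₁; letI := θ.instVβ₂; letI := θ.instιβ
      ∀ j, beta0OfMerged (betaMerged F (mergedTermFamilyMatT F N (TcanOfRecord F N) (chiFixed29 F N θ.ν θ.ε₂₉) θ.εbg) θ.ρ8 θ.bV) θ.v₀ j =
        secondMoment (TbalOf Lc Js j) 0 1)
    (h : Residue Lc Js Nc 0 1)
    (hπ : letI := θ.instVβ₁; letI := θ.instVβ₂; letI := θ.instιβ
      ∃ Js₀ : ℕ → JetData 3 F.L,
        (∀ j, beta0OfMerged (betaMerged F (mergedTermFamilyMatT F N (TcanOfRecord F N) (chiFixed29 F N θ.ν θ.ε₂₉) θ.εbg) θ.ρ8 θ.bV) θ.v₀ j =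
          secondMoment (TbalOf F.L Js₀ j) 0 1) ∧
        Residue F.L Js₀ (N : ℝ) 0 1) :
    B12Normalization.stepBal Nc Lc = B12Normalization.stepBal (N : ℝ) (F.L : ℝ) := by
  obtain ⟨Js₀, hβ₀, h₀⟩ := hπ
  exact stepBal_eq_of_two_data₁₃ F N θ hβ hβ₀ h h₀

variable (ε₀ B₃ a₀ a₁ : ℝ) (c₀ : B13.Consts) (M : ℕ) (α₂ B : ℝ)

variable {ε₀ B₃ a₀ a₁} in
/-- **★ ROW (D1) IN PRINT's LETTERS PAYS THE SEAM ROW BY MEMBER CHOICE — no slope question left**: if at every admissible member of the [15]-keyed family that has a (D1) datum at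
all there is one in print's letters (block `F.L`, colour numeral `N` — `hπ`, the natural print-faithful sharpening of `stub_d1Residue13` along the family), then §4's `hd₀` holds with
`d₀ := stepBal N F.L > 0` and ONE member `0 < ε₂₉`, `4ε₂₉ < ε₀` meets rows G ∧ Z ∧ N1 AND `ε₂₉ · K_rem,L ≤ stepBal Nc Lc` for EVERY (D1) datum of that member.  `hπ` NOT proved (row
(D1) ∕ N25, instance 0∕1); nothing of Bałaban's. [cite: Balaban1987RG1, (0.21) p.256, (2.9) p.266, (2.12)–(2.13) p.268 and (1.22) p.264; Balaban1988RG2Cluster, Lemma 3 (2.38) p.20 and p.21; Balaban1985Variational, Thm 1 p.279] -/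
theorem exists_eps29_rows_seam_at_data_theta13OfThm1C_of_print_data (hε : 0 < ε₀) (hB : 0 ≤ B₃) (ha₀ : 0 < a₀) (ha₁ : 0 < a₁)
    (hπ : ∀ e : ℝ, 0 < e → 4 * e < ε₀ → (theta13OfThm1C F N ε₀ e B₃ a₀ a₁).Admissible F N →
      letI := (theta13OfThm1C F N ε₀ e B₃ a₀ a₁).instVβ₁; letI := (theta13OfThm1C F N ε₀ e B₃ a₀ a₁).instVβ₂
      letI := (theta13OfThm1C F N ε₀ e B₃ a₀ a₁).instιβ
      ∀ (Lc : ℕ) (_ : NeZero Lc) (Js : ℕ → JetData 3 Lc) (Nc : ℝ),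
        (∀ j, beta0OfMerged (betaMerged F (mergedTermFamilyMatT F N (TcanOfRecord F N)
            (chiFixed29 F N (theta13OfThm1C F N ε₀ e B₃ a₀ a₁).ν (theta13OfThm1C F N ε₀ e B₃ a₀ a₁).ε₂₉) (theta13OfThm1C F N ε₀ e B₃ a₀ a₁).εbg)
            (theta13OfThm1C F N ε₀ e B₃ a₀ a₁).ρ8 (theta13OfThm1C F N ε₀ e B₃ a₀ a₁).bV) (theta13OfThm1C F N ε₀ e B₃ a₀ a₁).v₀ j =
          secondMoment (TbalOf Lc Js j) 0 1) →
        Residue Lc Js Nc 0 1 →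
        ∃ Js₀ : ℕ → JetData 3 F.L,
          (∀ j, beta0OfMerged (betaMerged F (mergedTermFamilyMatT F N (TcanOfRecord F N)
              (chiFixed29 F N (theta13OfThm1C F N ε₀ e B₃ a₀ a₁).ν (theta13OfThm1C F N ε₀ e B₃ a₀ a₁).ε₂₉) (theta13OfThm1C F N ε₀ e B₃ a₀ a₁).εbg)
              (theta13OfThm1C F N ε₀ e B₃ a₀ a₁).ρ8 (theta13OfThm1C F N ε₀ e B₃ a₀ a₁).bV) (theta13OfThm1C F N ε₀ e B₃ a₀ a₁).v₀ j =
            secondMoment (TbalOf F.L Js₀ j) 0 1) ∧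
          Residue F.L Js₀ (N : ℝ) 0 1) :
    ∃ ε₂₉ : ℝ, 0 < ε₂₉ ∧ 4 * ε₂₉ < ε₀ ∧
      (theta13OfThm1C F N ε₀ ε₂₉ B₃ a₀ a₁).Admissible F N ∧ (theta13OfThm1C F N ε₀ ε₂₉ B₃ a₀ a₁).ZtUnity F N ∧
      CondsL 4 (c13OfRecord₁₂ F N (theta13OfThm1C F N ε₀ ε₂₉ B₃ a₀ a₁).toStage12Params
          { c₀ with ε₁ := ε₂₉, A₂ := Real.exp 1 * 9 * 64 * K₀ 64 8 ^ 2 })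
        (((c13OfRecord₁₂ F N (theta13OfThm1C F N ε₀ ε₂₉ B₃ a₀ a₁).toStage12Params
          { c₀ with ε₁ := ε₂₉, A₂ := Real.exp 1 * 9 * 64 * K₀ 64 8 ^ 2 }).L : ℝ) / 2) ∧
      letI := (theta13OfThm1C F N ε₀ ε₂₉ B₃ a₀ a₁).instVβ₁; letI := (theta13OfThm1C F N ε₀ ε₂₉ B₃ a₀ a₁).instVβ₂
      letI := (theta13OfThm1C F N ε₀ ε₂₉ B₃ a₀ a₁).instιβ
      ∀ (Lc : ℕ) (_ : NeZero Lc) (Js : ℕ → JetData 3 Lc) (Nc : ℝ),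
        (∀ j, beta0OfMerged (betaMerged F (mergedTermFamilyMatT F N (TcanOfRecord F N)
            (chiFixed29 F N (theta13OfThm1C F N ε₀ ε₂₉ B₃ a₀ a₁).ν (theta13OfThm1C F N ε₀ ε₂₉ B₃ a₀ a₁).ε₂₉) (theta13OfThm1C F N ε₀ ε₂₉ B₃ a₀ a₁).εbg)
            (theta13OfThm1C F N ε₀ ε₂₉ B₃ a₀ a₁).ρ8 (theta13OfThm1C F N ε₀ ε₂₉ B₃ a₀ a₁).bV) (theta13OfThm1C F N ε₀ ε₂₉ B₃ a₀ a₁).v₀ j =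
          secondMoment (TbalOf Lc Js j) 0 1) →
        Residue Lc Js Nc 0 1 →
        ε₂₉ * remCoeffL 4 M (c13OfRecord₁₂ F N (theta13OfThm1C F N ε₀ ε₂₉ B₃ a₀ a₁).toStage12Params
            { c₀ with ε₁ := ε₂₉, A₂ := Real.exp 1 * 9 * 64 * K₀ 64 8 ^ 2 }) α₂ B ≤ B12Normalization.stepBal Nc Lc :=
  exists_eps29_rows_seam_at_data_theta13OfThm1C_of_drift_ge F N c₀ M α₂ B hε hB ha₀ ha₁ (stepBal_colour_block_pos F N)
    fun e he0 he4 hadm _ _ _ _ hβ hres =>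
      (stepBal_eq_print_of_print_datum₁₃ F N (theta13OfThm1C F N ε₀ e B₃ a₀ a₁) hβ hres (hπ e he0 he4 hadm _ inferInstance _ _ hβ hres)).ge

end Print

end Summit.QuantumFields.YangMills.Theorems.BalabanUVNodesN26SlopeOfRecord13

end
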